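import Mathlib
import Summits.KontsevichZagierPeriods.Zeta5Search.Profile19CellsA
import Summits.KontsevichZagierPeriods.Zeta5Search.Profile19CellsB
import Summits.KontsevichZagierPeriods.Zeta5Search.DenomLaw.Profile20Path
import Summits.KontsevichZagierPeriods.Zeta5Search.FlagRayDominance
import Summits.KontsevichZagierPeriods.Zeta5Search.DenomLaw.ZeroCoverKit
import HarnessLib

/-!
# ζ(5) search — PATH ACCOUNTING ON THE `N_p = 19` PROFILE OF THE FIRST PERIOD FOR EVERY SORTED PARAMETER VECTOR (general `b`; the double-drop bonus and the ZERO type-space law at `M = 8`)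

Cell `pub-zeta5` (HONEST FRAMING: systematic search; no irrationality claim unless certified), TRACK «DENOM-LAW» D1 prover seat
(denom-prover-d1 g17, `HOME/denom-law/prover-d1/ATTEMPT-17.md` §D).  Third general-`b` profile after `DenomLaw/FullProfilePath` (`N_p = 21`) and
`DenomLaw/Profile20Path` (`N_p = 20`): all seven parameters reach `p` and every pair block but the TWO smallest does — `p ≤ b₇`, `b₀ − b₁ − b₃ < p`,
`p ≤ b₀ − b₁ − b₄`, `p ≤ b₀ − b₂ − b₃` (inside the first period; the second-smallest block of a sorted vector is always `b₀ − b₁ − b₃`, the third is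
`min(b₀ − b₁ − b₄, b₀ − b₂ − b₃)`).  Then `N_p = 19` (`pairFloors_eq_19`), `C⋆ ≤ 11`, `p < d` and the node `DenomLaw.PathAccountingFirstPeriod` asks
`⌊d/p⌋ − 13` (`p < d < 4p` PROVED from the profile).  PROVED HERE for every sorted `b`: the machine-generated covers `FullProfile.cover19_ev / cover19_od`
(`Profile19Cells{A,B}`, 30 / 29 types; least multipole exponent `−8`, attained only by the centre-free palindrome `[1,−5,−5,1]`) pass (i) the DOUBLE-DROP
checks at `N = 8` (`checkB`, `checkLB` at `(−8, −5)`, fallback `checkLBx` at `(−8; −7, −4)`; `checkB19_ev/od`, `decide`), so `StairFLAG.cover_B_j`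
(`ClassTypeGuards.doubleDrop_of_cover` + THEOREM LB) gives `v_p(Cas_j(b)) ≥ −11` on the whole profile (`cas_ge19_neg11`, every `j`) — the node's value for
`⌊d/p⌋ ≤ 2`; and (ii) the three clauses of the ZERO-window class structure at `M = 8` with the tree's universal zero inventory (`ZeroWindows.D8 = [[1,−5,−5,1]]`,
extra pair `T1Rays.Sz8 = [[1,−6,−3,1]]`; kit `DenomLaw/ZeroCoverKit`, `decide` after fixing the parity flag), so where `3p ≤ d` (degree condition
`6p ≤ 2d + 1`) the ZERO type-space law (`ResidueLaw.typeSpaceLawZero_holds` via `DenomLaw.zero_Z8`) gives `6 − 2M = −10` (`cas_ge19_neg10`) — the node's value at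
`⌊d/p⌋ = 3`.  Hence **`pathAccounting_profile19`** (every `j`) and **`pathAccountingFirstPeriod_profile19`** (binders verbatim plus the four profile
inequalities), and (CV) on the whole profile (`profile19CV`).  With `DenomLaw/FullProfilePath` and `DenomLaw/Profile20Path`: the node holds for every sorted
`b` at every first-period prime at which all seven parameters and at least nineteen pair blocks reach `p` (the full profile needing `d < 4p`).  Recon beside
the proof (`g17/code/profile19_recon.py`, `p19_zero.py`, exhaustive `p ≤ 11`, 3,909 instances): double drop / THEOREM LB reach the node below `3p`, the zero
structure holds on all 3,909 (both covers), exact `v = −10` at sampled `⌊d/p⌋ = 3` instances.  MODEL/structure-side valuation bookkeeping of the cell's own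
rationals; nothing about ζ(5); no γ; records in print UNMOVED.
-/

open Finset

namespace Summit.KontsevichZagierPeriods.Zeta5Search.FullProfile

open Summit.KontsevichZagierPeriods.Zeta5Search.ClusterValuation
open Summit.KontsevichZagierPeriods.Zeta5Search.CasoratianValuation (InPolytope shift casoratian pairFloors refund)
open Summit.KontsevichZagierPeriods.Zeta5Search.WedgeDictionary (dOf)
open Summit.KontsevichZagierPeriods.Zeta5Search.ClassTypeCover
open Summit.KontsevichZagierPeriods.Zeta5Search.DenomLaw (cStar FirstPeriod Sorted7 zeroClasses_of_cover zero_Z8)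
open Summit.KontsevichZagierPeriods.Zeta5Search.ZeroWindows (ZeroWindowClasses)
open Summit.KontsevichZagierPeriods.Zeta5Search.DenomLaw.FirstPeriodKit (cStar_le_eleven sorted7_chain firstPeriod_pair pairFloors_expand)
open Summit.KontsevichZagierPeriods.Zeta5Search.StairTS3 (refund_le_pathHead)
open Summit.KontsevichZagierPeriods.Zeta5Search.StairFLAG (cover_B_j)
open Summit.KontsevichZagierPeriods.Zeta5Search.SortedProfile

/-! ## §1 The double-drop checks on the two covers -/

/-- THEOREM LB at `(−8, −5)`, `checkB` at `N = 8`, fallback `checkLBx` at `(−8; −7, −4)` on the `N_p = 19` types, `b₀` even. -/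
theorem checkB19_ev : checkLB false
      [([1, -5, 1], true), ([1, -6, 1], false), ([1, 1, -6, 1], false), ([1, 0, -6, 1], false), ([1, -1, -6, 1], false), ([1, -2, -6, 1], false), ([1, -3, -6, 1], false), ([1, -3, -5, 1], false), ([1, -4, -5, 1], false), ([1, -4, -4, 1], false), ([1, -5, -5, 1], false), ([1, -5, -4, 1], false), ([1, -5, -3, 1], false), ([1, -6, -3, 1], false), ([1, -6, -2, 1], false), ([1, -6, -1, 1], false), ([1, -6, 0, 1], false), ([1, -6, 1, 1], false), ([1, 1, -5, 1, 1], true), ([1, 1, -6, -3, 1], false), ([1, 1, -6, -2, 1], false), ([1, 1, -6, -1, 1], false), ([1, 1, -6, 0, 1], false), ([1, 1, -6, 1, 1], false), ([1, 0, -5, 0, 1], true), ([1, 0, -6, 0, 1], false), ([1, 0, -6, 1, 1], false), ([1, -1, -6, 1, 1], false), ([1, -2, -6, 1, 1], false), ([1, -3, -6, 1, 1], false)]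
      (-((8 : ℕ) : ℤ)) (-5) = true ∧ checkB false
      [([1, -5, 1], true), ([1, -6, 1], false), ([1, 1, -6, 1], false), ([1, 0, -6, 1], false), ([1, -1, -6, 1], false), ([1, -2, -6, 1], false), ([1, -3, -6, 1], false), ([1, -3, -5, 1], false), ([1, -4, -5, 1], false), ([1, -4, -4, 1], false), ([1, -5, -5, 1], false), ([1, -5, -4, 1], false), ([1, -5, -3, 1], false), ([1, -6, -3, 1], false), ([1, -6, -2, 1], false), ([1, -6, -1, 1], false), ([1, -6, 0, 1], false), ([1, -6, 1, 1], false), ([1, 1, -5, 1, 1], true), ([1, 1, -6, -3, 1], false), ([1, 1, -6, -2, 1], false), ([1, 1, -6, -1, 1], false), ([1, 1, -6, 0, 1], false), ([1, 1, -6, 1, 1], false), ([1, 0, -5, 0, 1], true), ([1, 0, -6, 0, 1], false), ([1, 0, -6, 1, 1], false), ([1, -1, -6, 1, 1], false), ([1, -2, -6, 1, 1], false), ([1, -3, -6, 1, 1], false)]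
      8 = true ∧ checkLBx false
      [([1, -5, 1], true), ([1, -6, 1], false), ([1, 1, -6, 1], false), ([1, 0, -6, 1], false), ([1, -1, -6, 1], false), ([1, -2, -6, 1], false), ([1, -3, -6, 1], false), ([1, -3, -5, 1], false), ([1, -4, -5, 1], false), ([1, -4, -4, 1], false), ([1, -5, -5, 1], false), ([1, -5, -4, 1], false), ([1, -5, -3, 1], false), ([1, -6, -3, 1], false), ([1, -6, -2, 1], false), ([1, -6, -1, 1], false), ([1, -6, 0, 1], false), ([1, -6, 1, 1], false), ([1, 1, -5, 1, 1], true), ([1, 1, -6, -3, 1], false), ([1, 1, -6, -2, 1], false), ([1, 1, -6, -1, 1], false), ([1, 1, -6, 0, 1], false), ([1, 1, -6, 1, 1], false), ([1, 0, -5, 0, 1], true), ([1, 0, -6, 0, 1], false), ([1, 0, -6, 1, 1], false), ([1, -1, -6, 1, 1], false), ([1, -2, -6, 1, 1], false), ([1, -3, -6, 1, 1], false)]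
      (-((8 : ℕ) : ℤ)) (-7) (-4) = true := by decide

/-- The same checks on the `N_p = 19` types, `b₀` odd. -/
theorem checkB19_od : checkLB true
      [([1, -6, 1], false), ([1, 1, -6, 1], false), ([1, 0, -6, 1], false), ([1, -1, -6, 1], false), ([1, -2, -6, 1], false), ([1, -3, -6, 1], false), ([1, -3, -5, 1], false), ([1, -4, -5, 1], false), ([1, -4, -4, 1], true), ([1, -4, -4, 1], false), ([1, -5, -5, 1], true), ([1, -5, -5, 1], false), ([1, -5, -4, 1], false), ([1, -5, -3, 1], false), ([1, -6, -3, 1], false), ([1, -6, -2, 1], false), ([1, -6, -1, 1], false), ([1, -6, 0, 1], false), ([1, -6, 1, 1], false), ([1, 1, -6, -3, 1], false), ([1, 1, -6, -2, 1], false), ([1, 1, -6, -1, 1], false), ([1, 1, -6, 0, 1], false), ([1, 1, -6, 1, 1], false), ([1, 0, -6, 0, 1], false), ([1, 0, -6, 1, 1], false), ([1, -1, -6, 1, 1], false), ([1, -2, -6, 1, 1], false), ([1, -3, -6, 1, 1], false)]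
      (-((8 : ℕ) : ℤ)) (-5) = true ∧ checkB true
      [([1, -6, 1], false), ([1, 1, -6, 1], false), ([1, 0, -6, 1], false), ([1, -1, -6, 1], false), ([1, -2, -6, 1], false), ([1, -3, -6, 1], false), ([1, -3, -5, 1], false), ([1, -4, -5, 1], false), ([1, -4, -4, 1], true), ([1, -4, -4, 1], false), ([1, -5, -5, 1], true), ([1, -5, -5, 1], false), ([1, -5, -4, 1], false), ([1, -5, -3, 1], false), ([1, -6, -3, 1], false), ([1, -6, -2, 1], false), ([1, -6, -1, 1], false), ([1, -6, 0, 1], false), ([1, -6, 1, 1], false), ([1, 1, -6, -3, 1], false), ([1, 1, -6, -2, 1], false), ([1, 1, -6, -1, 1], false), ([1, 1, -6, 0, 1], false), ([1, 1, -6, 1, 1], false), ([1, 0, -6, 0, 1], false), ([1, 0, -6, 1, 1], false), ([1, -1, -6, 1, 1], false), ([1, -2, -6, 1, 1], false), ([1, -3, -6, 1, 1], false)]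
      8 = true ∧ checkLBx true
      [([1, -6, 1], false), ([1, 1, -6, 1], false), ([1, 0, -6, 1], false), ([1, -1, -6, 1], false), ([1, -2, -6, 1], false), ([1, -3, -6, 1], false), ([1, -3, -5, 1], false), ([1, -4, -5, 1], false), ([1, -4, -4, 1], true), ([1, -4, -4, 1], false), ([1, -5, -5, 1], true), ([1, -5, -5, 1], false), ([1, -5, -4, 1], false), ([1, -5, -3, 1], false), ([1, -6, -3, 1], false), ([1, -6, -2, 1], false), ([1, -6, -1, 1], false), ([1, -6, 0, 1], false), ([1, -6, 1, 1], false), ([1, 1, -6, -3, 1], false), ([1, 1, -6, -2, 1], false), ([1, 1, -6, -1, 1], false), ([1, 1, -6, 0, 1], false), ([1, 1, -6, 1, 1], false), ([1, 0, -6, 0, 1], false), ([1, 0, -6, 1, 1], false), ([1, -1, -6, 1, 1], false), ([1, -2, -6, 1, 1], false), ([1, -3, -6, 1, 1], false)]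
      (-((8 : ℕ) : ℤ)) (-7) (-4) = true := by decide

/-! ## §2 The bound `−11` on the whole `N_p = 19` profile, every sorted `b`, every `j` -/

section Bounds

variable {b : ℕ → ℤ} {j p : ℕ}

/-- On the `N_p = 19` profile of the first period `p < d(b) < 4p`. -/
theorem d_bounds19 (hs : Sorted7 b) (hP : (p : ℤ) ≤ b 7) (hQ : b 0 < (p : ℤ) + b 1 + b 3) (hQ4 : (p : ℤ) + b 1 + b 4 ≤ b 0)
    (hF1 : b 1 < 2 * (p : ℤ)) (hF2 : b 0 < 2 * (p : ℤ) + b 6 + b 7) : (p : ℤ) < dOf b ∧ dOf b < 4 * (p : ℤ) := by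
  obtain ⟨h21, h32, h43, h54, h65, h76⟩ := sorted7_chain hs
  rw [DecompositionWholeCone.dOf_expand]; constructor <;> linarith

/-- **`N_p = 19`**: the two smallest pair digits are `0`, the other nineteen are `1`. -/
theorem pairFloors_eq_19 (hb : InPolytope b) (hs : Sorted7 b) (hp : 0 < p) (hQ : b 0 < (p : ℤ) + b 1 + b 3) (hQ4 : (p : ℤ) + b 1 + b 4 ≤ b 0)
    (hQ23 : (p : ℤ) + b 2 + b 3 ≤ b 0) (hfp : FirstPeriod b p) : pairFloors b p = 19 := by
  obtain ⟨h21, h32, h43, h54, h65, h76⟩ := sorted7_chain hs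
  obtain ⟨h0, hb1, hb2, hb3, -, -, -, -, hc1⟩ := box hb
  have hp0 : (0 : ℤ) < p := by exact_mod_cast hp
  have one : ∀ z : ℤ, (p : ℤ) ≤ z → z ≤ 2 * (p : ℤ) - 1 → z / (p : ℤ) = 1 := fun z h1 h2 => by
    rw [Int.ediv_eq_iff_of_pos hp0]; constructor <;> linarith
  have z12 : (b 0 - b 1 - b 2) / (p : ℤ) = 0 := Int.ediv_eq_zero_of_lt (by linarith) (by linarith)
  have z13 : (b 0 - b 1 - b 3) / (p : ℤ) = 0 := Int.ediv_eq_zero_of_lt (by linarith) (by linarith)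
  have U := fun (i k : ℕ) (hi : i < 7) (hk : k < 7) (hik : i < k) => firstPeriod_pair hfp hi hk hik
  rw [pairFloors_expand, z12, z13,
    one _ (by linarith) (U 0 3 (by norm_num) (by norm_num) (by norm_num)),
    one _ (by linarith) (U 0 4 (by norm_num) (by norm_num) (by norm_num)), one _ (by linarith) (U 0 5 (by norm_num) (by norm_num) (by norm_num)),
    one _ (by linarith) (U 0 6 (by norm_num) (by norm_num) (by norm_num)),
    one _ (by linarith) (U 1 2 (by norm_num) (by norm_num) (by norm_num)), one _ (by linarith) (U 1 3 (by norm_num) (by norm_num) (by norm_num)),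
    one _ (by linarith) (U 1 4 (by norm_num) (by norm_num) (by norm_num)), one _ (by linarith) (U 1 5 (by norm_num) (by norm_num) (by norm_num)),
    one _ (by linarith) (U 1 6 (by norm_num) (by norm_num) (by norm_num)), one _ (by linarith) (U 2 3 (by norm_num) (by norm_num) (by norm_num)),
    one _ (by linarith) (U 2 4 (by norm_num) (by norm_num) (by norm_num)), one _ (by linarith) (U 2 5 (by norm_num) (by norm_num) (by norm_num)),
    one _ (by linarith) (U 2 6 (by norm_num) (by norm_num) (by norm_num)), one _ (by linarith) (U 3 4 (by norm_num) (by norm_num) (by norm_num)),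
    one _ (by linarith) (U 3 5 (by norm_num) (by norm_num) (by norm_num)), one _ (by linarith) (U 3 6 (by norm_num) (by norm_num) (by norm_num)),
    one _ (by linarith) (U 4 5 (by norm_num) (by norm_num) (by norm_num)), one _ (by linarith) (U 4 6 (by norm_num) (by norm_num) (by norm_num)),
    one _ (by linarith) (U 5 6 (by norm_num) (by norm_num) (by norm_num))]
  norm_num

/-- **The double-drop bonus on the `N_p = 19` profile, general `b`**: `v_p(Cas_j(b)) ≥ −11` for every sorted `b` in the polytope, every admissible `j`, every
first-period prime `p ≥ 5` with `b₀ + 2 < p²` on the profile (least multipole exponent `−8` realised only by the centre-free palindrome `[1,−5,−5,1]`: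
`casLB + 2`; where it is not realised, THEOREM LB alone gives `−11`). -/
theorem cas_ge19_neg11 (hb : InPolytope b) (hs : Sorted7 b) (hbj : InPolytope (shift b j)) (hj1 : 1 ≤ j) (hj7 : j ≤ 7)
    (hprime : p.Prime) (hp5 : 5 ≤ p) (hwin : (b 0 + 2 : ℤ) < (p : ℤ) ^ 2) (hP : (p : ℤ) ≤ b 7) (hQ : b 0 < (p : ℤ) + b 1 + b 3)
    (hQ4 : (p : ℤ) + b 1 + b 4 ≤ b 0) (hQ23 : (p : ℤ) + b 2 + b 3 ≤ b 0) (hF1 : b 1 < 2 * (p : ℤ)) (hF2 : b 0 < 2 * (p : ℤ) + b 6 + b 7)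
    (hcas : casoratian b j ≠ 0) : (-11 : ℤ) ≤ padicValRat p (casoratian b j) := by
  haveI : Fact p.Prime := ⟨hprime⟩
  have hp2 : p % 2 = 1 := Nat.odd_iff.1 (hprime.odd_of_ne_two (by omega))
  obtain ⟨h0, hb1, hb2, hb3, hb4, -, -, -, -⟩ := box hb
  have hpd : (p : ℤ) ≤ dOf b := le_of_lt (d_bounds19 hs hP hQ hQ4 hF1 hF2).1
  have hpb : (p : ℤ) ≤ b 0 := by linarith
  rcases Int.emod_two_eq_zero_or_one (b 0) with hr | hr
  · obtain ⟨h1, h2, h3⟩ := checkB19_ev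
    exact cover_B_j hb hj1 hj7 hbj hprime hp5 hpb hpd hwin (cover19_ev hb hs hP hQ hQ4 hQ23 hF1 hF2 hp5 hp2 hr) (N := 8) (by norm_num) (by decide)
      (by rw [oddFlag_false hr]; exact h1) (by norm_num) (by rw [oddFlag_false hr]; exact h2) (by rw [oddFlag_false hr]; exact h3)
      (by norm_num) (by norm_num) (by norm_num) (by norm_num) hcas
  · obtain ⟨h1, h2, h3⟩ := checkB19_od
    exact cover_B_j hb hj1 hj7 hbj hprime hp5 hpb hpd hwin (cover19_od hb hs hP hQ hQ4 hQ23 hF1 hF2 hp5 hp2 hr) (N := 8) (by norm_num) (by decide)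
      (by rw [oddFlag_true hr]; exact h1) (by norm_num) (by rw [oddFlag_true hr]; exact h2) (by rw [oddFlag_true hr]; exact h3)
      (by norm_num) (by norm_num) (by norm_num) (by norm_num) hcas

/-- **The ZERO type-space law at `M = 8` on the `N_p = 19` profile, general `b`**: with `3p ≤ d(b)` (degree condition `6p ≤ 2d + 1`),
`v_p(Cas_j(b)) ≥ −10 = 6 − 2M` (class structure from the covers by `DenomLaw.zeroClasses_of_cover` with the universal zero inventory
`ZeroWindows.D8` / `T1Rays.Sz8`; no line data — pigeonhole on two doubled points). -/
theorem cas_ge19_neg10 (hb : InPolytope b) (hs : Sorted7 b) (hbj : InPolytope (shift b j)) (hj1 : 1 ≤ j) (hj7 : j ≤ 7)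
    (hprime : p.Prime) (hp5 : 5 ≤ p) (hwin : (b 0 + 2 : ℤ) < (p : ℤ) ^ 2) (hP : (p : ℤ) ≤ b 7) (hQ : b 0 < (p : ℤ) + b 1 + b 3)
    (hQ4 : (p : ℤ) + b 1 + b 4 ≤ b 0) (hQ23 : (p : ℤ) + b 2 + b 3 ≤ b 0) (hF1 : b 1 < 2 * (p : ℤ)) (hF2 : b 0 < 2 * (p : ℤ) + b 6 + b 7)
    (hd : 3 * (p : ℤ) ≤ dOf b) (hcas : casoratian b j ≠ 0) : (-10 : ℤ) ≤ padicValRat p (casoratian b j) := by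
  haveI : Fact p.Prime := ⟨hprime⟩
  have hp2 : p % 2 = 1 := Nat.odd_iff.1 (hprime.odd_of_ne_two (by omega))
  obtain ⟨h0, hb1, hb2, hb3, hb4, -, -, -, -⟩ := box hb
  have hpb : (p : ℤ) ≤ b 0 := by linarith
  have hdeg : (p : ℤ) * 6 ≤ 2 * dOf b + 1 := by linarith
  have hC : ZeroWindowClasses b p 8 ZeroWindows.D8 T1Rays.Sz8 := by
    rcases Int.emod_two_eq_zero_or_one (b 0) with hr | hr
    · exact zeroClasses_of_cover h0 (cover19_ev hb hs hP hQ hQ4 hQ23 hF1 hF2 hp5 hp2 hr) (by rw [oddFlag_false hr]; decide)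
    · exact zeroClasses_of_cover h0 (cover19_od hb hs hP hQ hQ4 hQ23 hF1 hF2 hp5 hp2 hr) (by rw [oddFlag_true hr]; decide)
  exact zero_Z8 hb hbj hj1 hj7 hprime hp5 hpb hwin hC hdeg hcas

end Bounds

/-! ## §3 PATH accounting on the whole `N_p = 19` profile, every sorted `b` -/

/-- **`PathAccountingFirstPeriod`'s conclusion on the `N_p = 19` profile for EVERY sorted `b`, every direction `j`**: `b` sorted in the polytope with
`b + e_j` in the polytope, a first-period prime `p ≥ 5` with `b₀ + 2 < p²`, all seven parameters reaching `p` and exactly the two smallest pair blocks short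
of `p` (`b₀ − b₁ − b₃ < p ≤ min(b₀ − b₁ − b₄, b₀ − b₂ − b₃)`): `⌊d/p⌋ − N_p − min([⌊d/p⌋ ≥ 2], 5 − C⋆) ≤ v_p(Cas_j(b))`. -/
theorem pathAccounting_profile19 (b : ℕ → ℤ) (j p : ℕ) (hb : InPolytope b) (hs : Sorted7 b) (hbj : InPolytope (shift b j))
    (hj1 : 1 ≤ j) (hj7 : j ≤ 7) (hprime : p.Prime) (hp5 : 5 ≤ p) (hwin : (b 0 + 2 : ℤ) < (p : ℤ) ^ 2) (hfp : FirstPeriod b p)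
    (hP : (p : ℤ) ≤ b 7) (hQ : b 0 < (p : ℤ) + b 1 + b 3) (hQ4 : (p : ℤ) + b 1 + b 4 ≤ b 0) (hQ23 : (p : ℤ) + b 2 + b 3 ≤ b 0)
    (hcas : casoratian b j ≠ 0) :
    dOf b / (p : ℤ) - pairFloors b p - min (if 2 ≤ dOf b / (p : ℤ) then (1 : ℤ) else 0) (5 - (cStar b p : ℤ))
      ≤ padicValRat p (casoratian b j) := by
  obtain ⟨hF1, hF2⟩ := fp_bounds hfp
  have hp0 : (0 : ℤ) < p := by exact_mod_cast hprime.pos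
  obtain ⟨-, hdhi⟩ := d_bounds19 hs hP hQ hQ4 hF1 hF2
  rw [pairFloors_eq_19 hb hs hprime.pos hQ hQ4 hQ23 hfp]
  have hC11 : (cStar b p : ℤ) ≤ 11 := by exact_mod_cast cStar_le_eleven b p
  have hmin : -6 ≤ min (if 2 ≤ dOf b / (p : ℤ) then (1 : ℤ) else 0) (5 - (cStar b p : ℤ)) :=
    le_min (by split_ifs <;> norm_num) (by linarith)
  have hfd4 : dOf b / (p : ℤ) < 4 := by rw [Int.ediv_lt_iff_lt_mul hp0]; linarith
  by_cases h3 : 3 * (p : ℤ) ≤ dOf b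
  · linarith [cas_ge19_neg10 hb hs hbj hj1 hj7 hprime hp5 hwin hP hQ hQ4 hQ23 hF1 hF2 h3 hcas]
  push Not at h3
  have hfd3 : dOf b / (p : ℤ) < 3 := by rw [Int.ediv_lt_iff_lt_mul hp0]; linarith
  linarith [cas_ge19_neg11 hb hs hbj hj1 hj7 hprime hp5 hwin hP hQ hQ4 hQ23 hF1 hF2 hcas]

/-- **THE NODE ON THE `N_p = 19` PROFILE, EVERY SORTED `b`: `PathAccountingFirstPeriod` with its binders VERBATIM plus four hypotheses** — `p ≤ b₇`,
`b₀ < p + b₁ + b₃`, `p + b₁ + b₄ ≤ b₀`, `p + b₂ + b₃ ≤ b₀` (all parameters and all pair blocks but the two smallest reach `p`). -/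
theorem pathAccountingFirstPeriod_profile19 :
    ∀ (b : ℕ → ℤ) (p : ℕ), InPolytope b → Sorted7 b → InPolytope (shift b 7) →
      p.Prime → 5 ≤ p → (b 0 + 2 : ℤ) < (p : ℤ) ^ 2 → FirstPeriod b p →
      (p : ℤ) ≤ b 7 → b 0 < (p : ℤ) + b 1 + b 3 → (p : ℤ) + b 1 + b 4 ≤ b 0 → (p : ℤ) + b 2 + b 3 ≤ b 0 → casoratian b 7 ≠ 0 →
        dOf b / (p : ℤ) - pairFloors b p - min (if 2 ≤ dOf b / (p : ℤ) then (1 : ℤ) else 0) (5 - (cStar b p : ℤ))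
          ≤ padicValRat p (casoratian b 7) :=
  fun b p hb hs hb7 hprime hp5 hwin hfp hP hQ hQ4 hQ23 hcas =>
    pathAccounting_profile19 b 7 p hb hs hb7 (by norm_num) (by norm_num) hprime hp5 hwin hfp hP hQ hQ4 hQ23 hcas

/-- **(CV) on the whole `N_p = 19` profile, every sorted `b`, every `j`** (the (CV) value `refund − N_p` never exceeds the PATH value). -/
theorem profile19CV (b : ℕ → ℤ) (j p : ℕ) (hb : InPolytope b) (hs : Sorted7 b) (hbj : InPolytope (shift b j))
    (hj1 : 1 ≤ j) (hj7 : j ≤ 7) (hprime : p.Prime) (hp5 : 5 ≤ p) (hwin : (b 0 + 2 : ℤ) < (p : ℤ) ^ 2) (hfp : FirstPeriod b p)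
    (hP : (p : ℤ) ≤ b 7) (hQ : b 0 < (p : ℤ) + b 1 + b 3) (hQ4 : (p : ℤ) + b 1 + b 4 ≤ b 0) (hQ23 : (p : ℤ) + b 2 + b 3 ≤ b 0)
    (hcas : casoratian b j ≠ 0) : refund b p - pairFloors b p ≤ padicValRat p (casoratian b j) := by
  linarith [refund_le_pathHead b p (5 - (cStar b p : ℤ)),
    pathAccounting_profile19 b j p hb hs hbj hj1 hj7 hprime hp5 hwin hfp hP hQ hQ4 hQ23 hcas]

end Summit.KontsevichZagierPeriods.Zeta5Search.FullProfile
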